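import Summits.QuantumFields.YangMills.Theorems.ColdStartUniversalityLatticeLangevinBlockLoopStringMixing
import Summits.QuantumFields.YangMills.Theorems.ColdStartUniversalityUniformColdStartMixingFixedCutoffMacroscopicWindow
import HarnessLib

/-!
# Route `ColdStartUniversality`, aside K_A1 `UniformColdStartMixing` (24809): BLOCK-AVERAGED LOOP STRINGS EQUILIBRATE AT THE CUT-OFFS OF THE
# STRONG-COUPLING WINDOW `γε_K > 6`, POINTWISE IN PHYSICAL TIME, with a threshold depending on the cut-off only through `ε_K`, `ρ_K` and the
# NUMBER OF BLOCKS `L_K³/#B` — the closest UNCONDITIONAL analogue of the crux's conclusion for smooth observables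

Helper file (seat `ym-line-csu-p1`, g28; `--supports stmt-QuantumFields-24809`).  Window reading (`window_coupling_bounds`: `|β'_K| < 1/12`, `1 − 12β'_K =
ρ_K := 1 − 6/(γε_K)`) of `wilson_coldStart_blockLoopString_le_blocks`: for a nonempty block `B` of base points and rectangles `(i_k, j_k, R_k × T_k)`,
`W̄_(B,k) = (#B)⁻¹Σ_(x∈B) W_(R_k×T_k)(x; i_k, j_k)` (the crux tests `∏_(C∈os)` of UNIT-BLOCK averaged loops; here the smooth `½Re tr` version):
* ★★★ `coldStart_blockLoopString_fixedCutoff_window` — at a cut-off `K` with `6 < γε_K`, every solution of the SZZ dynamics at `β'_K` from any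
  deterministic start, every lattice time `u ≥ 0`:
  `|E ∏_k W̄_(B,k)(U_(2+u)) − ∫∏_k W̄_(B,k) dμ_K| ≤ e^(−ρ_K u)·(Σ_k(R_k+T_k))·√(32(366β'_K+3)(L_K³/#B)/ρ_K)`;
* ★★★ `coldStart_blockLoopString_physicalTime_fixedCutoff_window` — in physical time `s = ε_K t`: for every `δ > 0` and every
  `s ≥ 2ε_K + ε_K·log(C_K/δ)/ρ_K` (and `s ≥ 2ε_K`), `C_K = (Σ_k(R_k+T_k))√(32(366β'_K+3)(L_K³/#B)/ρ_K)`: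
  `|E ∏_k W̄_(B,k)(U(s/ε_K)) − ∫∏_k W̄_(B,k) dμ_K| ≤ δ`.
With unit PHYSICAL blocks (`L_K³/#B = ℓ³`) the threshold involves `L_K` not at all.  PLANNER-FACING, HONEST: only the COARSE cut-offs `γε_K > 6`; smooth
`½Re tr` block averages, not Bałaban's `avgObs expMeanLogSU`; nothing K-uniform; 24809 ASIDE and NOT restated; no crux, rung or summit statement is proved;
the Yang–Mills mass gap is NOT proved.  THEOREMS ONLY, no definition, no sorry. [cite: ShenZhuZhu2022, §4 Theorem 4.2, Corollary 4.4]
-/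

set_option autoImplicit false

noncomputable section

namespace Summit.QuantumFields.YangMills.Theorems.ColdStartUniversality

open MeasureTheory ProbabilityTheory Finset
open scoped NNReal ENNReal BigOperators
open Literature.Probability.Process Literature.MathematicalPhysics.QuantumFieldTheory
open Literature.MathematicalPhysics.QuantumLattice (fundamentalRep fundamentalLatticeRep continuous_fundamentalRep)
open Literature.MathematicalPhysics.QuantumFieldTheory.Balaban1983to89

/-- ★★★ **Block-averaged loop strings at a window cut-off, lattice time.**  For `6 < γε_K` (`ρ_K = 1 − 6/(γε_K)`), every nonempty block `B`, every
loop family with `Σ_k(R_k+T_k) > 0`, every solution at `β'_K` from a deterministic start and every `u ≥ 0`: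
`|E ∏_k W̄_(B,k)(U_(2+u)) − ∫∏_k W̄_(B,k) dμ_K| ≤ e^(−ρ_K u)·(Σ_k(R_k+T_k))·√(32(366|β'_K|+3)(L_K³/#B)/ρ_K)`. [cite: ShenZhuZhu2022, §4 Theorem 4.2, Corollary 4.4] -/
theorem coldStart_blockLoopString_fixedCutoff_window (F : T3ContinuumYM3Torus.T3Family) (γ : ℝ) (K : ℕ) (hK : 6 < γ * (F.P K).eps)
    (B : Finset (Site 3 ((F.P K).sitesPerDir 0))) (hB : B.Nonempty) (m : ℕ) (i j : Fin m → Fin 3) (R T : Fin m → ℕ) (hRT : 0 < ∑ k, (R k + T k))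
    (z : GaugeConfig 3 ((F.P K).sitesPerDir 0) (Matrix.specialUnitaryGroup (Fin 2) ℂ))
    {Ω : Type} [MeasurableSpace Ω] {P : Measure Ω} [IsProbabilityMeasure P]
    {W : ℝ≥0 → Ω → (Edge 3 ((F.P K).sitesPerDir 0) × NoiseIdx 2 → ℝ)} (hW : IsFlatBrownian W P)
    {U : ℝ≥0 → Ω → GaugeConfig 3 ((F.P K).sitesPerDir 0) (Matrix.specialUnitaryGroup (Fin 2) ℂ)} (hU0 : ∀ ω, U 0 ω = z)
    (hU : (latticeLangevinDynamics (fundamentalLatticeRep 2) ((γ * (F.P K).eps)⁻¹ / 2)).IsSolution (fundamentalRep (Fin 2)) hW.natFiltration P W U)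
    (u : ℝ≥0) :
    |(∫ ω, (∏ k : Fin m, (((B.card : ℝ))⁻¹ * ∑ x ∈ B, wilsonLoop (fundamentalRep (Fin 2)) x (i k) (j k) (R k) (T k) (U ((2 : ℝ≥0) + u) ω))) ∂P) - ∫ V, (∏ k : Fin m, (((B.card : ℝ))⁻¹ * ∑ x ∈ B, wilsonLoop (fundamentalRep (Fin 2)) x (i k) (j k) (R k) (T k) V)) ∂(wilsonMeasure (d := 3) (L := ((F.P K).sitesPerDir 0)) (fundamentalRep (Fin 2)) ((γ * (F.P K).eps)⁻¹ / 2))| ≤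
      Real.exp (-(1 - 6 / (γ * (F.P K).eps)) * u) * ((∑ k : Fin m, ((R k : ℝ) + T k)) * Real.sqrt (32 * (366 * |((γ * (F.P K).eps)⁻¹ / 2)| + 3) * (((((F.P K).sitesPerDir 0) : ℕ) : ℝ) ^ 3 / (B.card : ℝ)) / (1 - 6 / (γ * (F.P K).eps)))) := by
  obtain ⟨hβ, hrate⟩ := window_coupling_bounds F γ K hK
  have h := wilson_coldStart_blockLoopString_le_blocks ((F.P K).sitesPerDir 0) ((γ * (F.P K).eps)⁻¹ / 2) hβ m i j R T hRT B hB z hW hU0 hU u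
  rw [hrate] at h
  exact h

/-- ★★★ **Block-averaged loop strings at a window cut-off, PHYSICAL time, pointwise.**  For `6 < γε_K`, `δ > 0`, and every physical time `s` with
`2ε_K ≤ s` and `2ε_K + ε_K·log(C_K/δ)/ρ_K ≤ s`, `C_K = (Σ_k(R_k+T_k))√(32(366|β'_K|+3)(L_K³/#B)/ρ_K)`:
`|E ∏_k W̄_(B,k)(U(s/ε_K)) − ∫∏_k W̄_(B,k) dμ_K| ≤ δ` (`U (s/ε_K).toNNReal` as in the crux). [cite: ShenZhuZhu2022, §4 Theorem 4.2, Corollary 4.4] -/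
theorem coldStart_blockLoopString_physicalTime_fixedCutoff_window (F : T3ContinuumYM3Torus.T3Family) (γ : ℝ) (K : ℕ) (hK : 6 < γ * (F.P K).eps)
    (B : Finset (Site 3 ((F.P K).sitesPerDir 0))) (hB : B.Nonempty) (m : ℕ) (i j : Fin m → Fin 3) (R T : Fin m → ℕ) (hRT : 0 < ∑ k, (R k + T k))
    (z : GaugeConfig 3 ((F.P K).sitesPerDir 0) (Matrix.specialUnitaryGroup (Fin 2) ℂ))
    {Ω : Type} [MeasurableSpace Ω] {P : Measure Ω} [IsProbabilityMeasure P]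
    {W : ℝ≥0 → Ω → (Edge 3 ((F.P K).sitesPerDir 0) × NoiseIdx 2 → ℝ)} (hW : IsFlatBrownian W P)
    {U : ℝ≥0 → Ω → GaugeConfig 3 ((F.P K).sitesPerDir 0) (Matrix.specialUnitaryGroup (Fin 2) ℂ)} (hU0 : ∀ ω, U 0 ω = z)
    (hU : (latticeLangevinDynamics (fundamentalLatticeRep 2) ((γ * (F.P K).eps)⁻¹ / 2)).IsSolution (fundamentalRep (Fin 2)) hW.natFiltration P W U)
    {δ : ℝ} (hδ : 0 < δ) (s : ℝ) (h2 : 2 * (F.P K).eps ≤ s)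
    (hs : 2 * (F.P K).eps + (F.P K).eps * Real.log (((∑ k : Fin m, ((R k : ℝ) + T k)) * Real.sqrt (32 * (366 * |((γ * (F.P K).eps)⁻¹ / 2)| + 3) * (((((F.P K).sitesPerDir 0) : ℕ) : ℝ) ^ 3 / (B.card : ℝ)) / (1 - 6 / (γ * (F.P K).eps)))) / δ) / (1 - 6 / (γ * (F.P K).eps)) ≤ s) :
    |(∫ ω, (∏ k : Fin m, (((B.card : ℝ))⁻¹ * ∑ x ∈ B, wilsonLoop (fundamentalRep (Fin 2)) x (i k) (j k) (R k) (T k) (U (s / (F.P K).eps).toNNReal ω))) ∂P) - ∫ V, (∏ k : Fin m, (((B.card : ℝ))⁻¹ * ∑ x ∈ B, wilsonLoop (fundamentalRep (Fin 2)) x (i k) (j k) (R k) (T k) V)) ∂(wilsonMeasure (d := 3) (L := ((F.P K).sitesPerDir 0)) (fundamentalRep (Fin 2)) ((γ * (F.P K).eps)⁻¹ / 2))| ≤ δ := by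
  have he : 0 < (F.P K).eps := (F.P K).eps_pos
  have hγε : 0 < γ * (F.P K).eps := lt_trans (by norm_num) hK
  have hρ : 0 < (1 - 6 / (γ * (F.P K).eps)) := by
    rw [sub_pos, div_lt_one hγε]; exact hK
  have hS : (0 : ℝ) < (B.card : ℝ) := by exact_mod_cast hB.card_pos
  have hRT' : (0 : ℝ) < (∑ k : Fin m, ((R k : ℝ) + T k)) := by
    have h' : ((∑ k, (R k + T k) : ℕ) : ℝ) = (∑ k : Fin m, ((R k : ℝ) + T k)) := by push_cast; rfl
    rw [← h']; exact_mod_cast hRT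
  obtain ⟨hsplit, hu⟩ := toNNReal_div_eq_two_add he h2
  rw [hsplit]
  have hb := coldStart_blockLoopString_fixedCutoff_window F γ K hK B hB m i j R T hRT z hW hU0 hU (s / (F.P K).eps - 2).toNNReal
  refine hb.trans ?_
  obtain ⟨C, hC⟩ : ∃ C : ℝ, ((∑ k : Fin m, ((R k : ℝ) + T k)) * Real.sqrt (32 * (366 * |((γ * (F.P K).eps)⁻¹ / 2)| + 3) * (((((F.P K).sitesPerDir 0) : ℕ) : ℝ) ^ 3 / (B.card : ℝ)) / (1 - 6 / (γ * (F.P K).eps)))) = C := ⟨_, rfl⟩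
  rw [hC] at hs ⊢
  have hLpos : (0 : ℝ) < (((((F.P K).sitesPerDir 0) : ℕ) : ℝ)) ^ 3 := by
    have : 0 < ((F.P K).sitesPerDir 0) := Nat.pos_of_ne_zero (NeZero.ne _)
    positivity
  have hCpos : 0 < C := by
    rw [← hC]
    refine mul_pos hRT' (Real.sqrt_pos.2 ?_)
    refine div_pos (mul_pos (mul_pos (by norm_num) ?_) (div_pos hLpos hS)) hρ
    positivity
  -- `e^(−ρ u) ≤ δ/C` from `u = s/ε − 2 ≥ log(C/δ)/ρ`
  have hu' : Real.log (C / δ) ≤ (1 - 6 / (γ * (F.P K).eps)) * (s / (F.P K).eps - 2) := by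
    have h1 : (F.P K).eps * Real.log (C / δ) / (1 - 6 / (γ * (F.P K).eps)) ≤ s - 2 * (F.P K).eps := by linarith
    rw [div_le_iff₀ hρ] at h1
    have h3 : Real.log (C / δ) * (F.P K).eps ≤ ((1 - 6 / (γ * (F.P K).eps)) * (s / (F.P K).eps - 2)) * (F.P K).eps := by
      have e : ((1 - 6 / (γ * (F.P K).eps)) * (s / (F.P K).eps - 2)) * (F.P K).eps = (s - 2 * (F.P K).eps) * (1 - 6 / (γ * (F.P K).eps)) := by
        field_simp
      rw [e]; linarith
    exact le_of_mul_le_mul_right h3 he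
  have hexp : Real.exp (-(1 - 6 / (γ * (F.P K).eps)) * (((s / (F.P K).eps - 2).toNNReal : ℝ≥0) : ℝ)) ≤ δ / C := by
    rw [hu]
    have h1 : Real.exp (-(1 - 6 / (γ * (F.P K).eps)) * (s / (F.P K).eps - 2)) ≤ Real.exp (-Real.log (C / δ)) := Real.exp_le_exp.2 (by linarith)
    rw [Real.exp_neg (Real.log (C / δ)), Real.exp_log (div_pos hCpos hδ), inv_div] at h1
    exact h1
  calc Real.exp (-(1 - 6 / (γ * (F.P K).eps)) * (((s / (F.P K).eps - 2).toNNReal : ℝ≥0) : ℝ)) * C ≤ δ / C * C :=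
        mul_le_mul_of_nonneg_right hexp hCpos.le
    _ = δ := div_mul_cancel₀ δ hCpos.ne'

end Summit.QuantumFields.YangMills.Theorems.ColdStartUniversality
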